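import Literature.NumberTheory.EllipticCurves.SemistableModPImageMultiplicativeProofs
import Literature.NumberTheory.EllipticCurves.SemistableModPImageAbelianProofs
import Literature.NumberTheory.EllipticCurves.SerreOpenImageFinalProofs
import Literature.NumberTheory.EllipticCurves.OpenImageMazurTwistProofs
import Literature.NumberTheory.EllipticCurves.OpenImageMazurGoodAtNProofs
import Literature.NumberTheory.EllipticCurves.LFunctionPrimeCoeff
import Literature.NumberTheory.EllipticCurves.SemistableModPImage
import HarnessLib

/-!
# Semistable mod-`p` images, the reducible case: a stable line of `E[p]` has trivial
# sub-character or trivial quotient character (Serre 1972, §5.4, Prop. 21 ii), Lemmes 5–6)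

`Proofs` file (theorems only, no definitions, no named facts), topic `NumberTheory/EllipticCurves`;
third sibling of `SemistableModPImage.lean` on the way to the named fact
`Literature.NumberTheory.EllipticCurves.Edixhoven1997_prop_2_1` (B. Edixhoven, *Serre's
conjecture*, Prop. 2.1 = J.-P. Serre, Invent. Math. 15 (1972), §5.4, Prop. 21).

Let `E = W/ℚ` be an elliptic curve in global minimal form which is semistable (good or
multiplicative reduction at every finite place of `ℚ`), `p` a prime and `H ⊂ E[p]` a
`Γ_ℚ`-stable subgroup, `H ≠ 0, E[p]` (a stable line; `ρ̄_{E,p}` is reducible).  Serre (§5.4,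
"Démonstration de ii)"): the two characters `χ', χ''` of `Γ_ℚ` on `H` and on `E[p]/H` are
unramified outside `p` (Lemme 6: at a good `q ≠ p` the module `E[p]` is unramified, at a
multiplicative `q ≠ p` "on vérifie facilement sur le modèle de Tate que le groupe d'inertie … est,
soit trivial, soit d'ordre `l`"), one of them is unramified at `p` (Lemme 5: the reduction at `p`
is ordinary or multiplicative, and then the Corollaries to Prop. 11 and Prop. 13 of §1 apply), and
"`ℚ` n'admet pas d'extension non ramifiée de degré `> 1`", so `χ' = 1` or `χ'' = 1`.

* `WeierstrassCurve.smul_eq_or_smul_sub_mem_of_stable` — **the main statement**: `Γ_ℚ` fixes `H`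
  pointwise, or acts trivially on `E[p]/H`.

The proof follows Serre with the tree's tools: the isogeny character `r = χ'` of the stable line
(`Mazur1978`-namespace API of `OpenImageMazurProofs`: `exists_isogenyCharacter`, and the shape
`χ'' = χ̄_p r⁻¹`, `smul_sub_smul_mem_zmultiples_of_isogenyCharacter`); `r` is trivial on the
inertia groups away from `p` (`isogenyCharacter_eq_one_of_mem_inertia` at the good places,
`smul_smul_sub_eq_of_mem_inertia_geomPoints` — unipotence — at the multiplicative ones); hence by
Kronecker–Weber and Minkowski `r = χ̄_pᵏ` globally
(`Mazur1978.exists_forall_eq_mul_modNCyclotomicCharacter_pow` with `n = 1`, which contains "an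
everywhere unramified character of `Γ_ℚ` is trivial"); and `k ≡ 0` or `1 (mod p - 1)` by the
local structure at `p`: automatic for `p ≤ 3`, and for `p ≥ 5` from the ordinary line
(`exists_line_of_not_dvd_frobeniusTrace_of_mem_primesAbove`, §1.11 Prop. 11), the impossibility of
supersingular reduction (`isCyclic_and_card_inertia_map_of_dvd_frobeniusTrace`, §1.11 Prop. 12:
a cyclic inertia image of order `p² - 1` stabilises no line — Lemme 5), or the multiplicative line
(`exists_addSubgroup_card_le_of_hasMultiplicativeReductionAt`, §1.12 Cor. of Prop. 13).

## References

* [Serre1972] J.-P. Serre, *Propriétés galoisiennes des points d'ordre fini des courbes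
  elliptiques*, Invent. Math. 15 (1972) 259–331, §5.4 (Prop. 21 ii), Lemme 5, Lemme 6), §1.11,
  §1.12.
* [Edixhoven1997] B. Edixhoven, *Serre's conjecture*, in Cornell–Silverman–Stevens (1997),
  Prop. 2.1 (PDF p. 285): "If `ρ_p` is reducible Serre's argument shows that its
  semi-simplification is `1 ⊕ χ_p`."
-/

noncomputable section

open scoped Classical NumberField
open IsDedekindDomain Field NumberField

namespace WeierstrassCurve

open Literature.NumberTheory.EllipticCurves Literature.NumberTheory.GaloisRepresentations
  Rat.HeightOneSpectrum

variable (W : WeierstrassCurve ℚ) [W.IsElliptic] (p : ℕ) [hp : Fact p.Prime]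

/-! ### Stable lines and the isogeny character -/

/-- A subgroup of `E[p]` other than `0` and `E[p]` is a line `𝔽_p P`, `P ≠ 0` (`#E[p] = p²`).
[folklore] -/
theorem exists_eq_zmultiples_of_ne_bot_of_ne_top (H : AddSubgroup (geomTorsion W p))
    (hbot : H ≠ ⊥) (htop : H ≠ ⊤) :
    ∃ P : geomTorsion W p, P ∈ H ∧ P ≠ 0 ∧ H = AddSubgroup.zmultiples P := by
  letI : Module (ZMod p) (geomTorsion W p) := AddSubgroup.torsionBy.zmodModule
  have hpp : p.Prime := hp.out
  have hcard : Nat.card (geomTorsion W p) = p ^ 2 :=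
    card_torsionPoints_eq_sq_holds W (AlgebraicClosure ℚ) (n := p)
      (Nat.cast_ne_zero.mpr hpp.ne_zero)
  haveI : Finite (geomTorsion W p) :=
    Nat.finite_of_card_ne_zero (by rw [hcard]; exact pow_ne_zero _ hpp.ne_zero)
  obtain ⟨P, hPH, hP0⟩ : ∃ P ∈ H, P ≠ (0 : geomTorsion W p) := by
    by_contra h
    push Not at h
    exact hbot ((AddSubgroup.eq_bot_iff_forall _).mpr h)
  refine ⟨P, hPH, hP0, ?_⟩
  have hordP : addOrderOf P = p := addOrderOf_eq_prime_of_ne_zero hP0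
  have hle : AddSubgroup.zmultiples P ≤ H := AddSubgroup.zmultiples_le_of_mem hPH
  have hcardH : Nat.card H ∣ p ^ 2 := hcard ▸ H.card_addSubgroup_dvd_card
  obtain ⟨i, hi, hHi⟩ := (Nat.dvd_prime_pow hpp).mp hcardH
  have hcardZ : Nat.card (AddSubgroup.zmultiples P) = p := by
    rw [Nat.card_zmultiples, hordP]
  interval_cases i
  · exfalso
    rw [pow_zero] at hHi
    exact hbot (AddSubgroup.eq_bot_of_card_eq H hHi)
  · symm
    apply AddSubgroup.eq_of_le_of_card_ge hle
    rw [hHi, hcardZ, pow_one]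
  · exfalso
    apply htop
    apply AddSubgroup.eq_top_of_card_eq
    rw [hHi, hcard]

variable {W p}

/-- **Lemme 6, away from `p`**: for a semistable `E/ℚ`, the isogeny character `r` of a stable line
`𝔽_p P ⊂ E[p]` is trivial on the inertia groups of the primes of `\bar ℤ` not above `p` (at a good
place `E[p]` is unramified; at a multiplicative place the inertia acts unipotently, so its
eigenvalue on `P` is `1`). [cite: Serre1972, §5.4, Lemme 6] -/
theorem isogenyCharacter_eq_one_of_mem_inertia_of_isSemistable (hsemi : W.IsSemistable (𝓞 ℚ))
    {P : geomTorsion W p} (hP0 : P ≠ 0) {r : absoluteGaloisGroup ℚ →* (ZMod p)ˣ}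
    (hr : ∀ σ : absoluteGaloisGroup ℚ, σ • P = ((r σ : (ZMod p)ˣ) : ZMod p).val • P)
    {v : HeightOneSpectrum (𝓞 ℚ)} (hpv : (p : 𝓞 ℚ) ∉ v.asIdeal)
    {𝔓 : Ideal (absIntegers (𝓞 ℚ) ℚ)} (h𝔓 : 𝔓 ∈ v.primesAbove)
    {τ : absoluteGaloisGroup ℚ} (hτ : τ ∈ 𝔓.inertia (absoluteGaloisGroup ℚ)) : r τ = 1 := by
  have hpp : p.Prime := hp.out
  haveI : NeZero p := ⟨hpp.ne_zero⟩
  rcases hsemi v with hgood | hmult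
  · exact Mazur1978.isogenyCharacter_eq_one_of_mem_inertia W p hP0 hr hgood hpv h𝔓 hτ
  · -- multiplicative place: unipotent inertia
    have hP0' : (P : geomPoints W) ≠ 0 := fun h ↦ hP0 (Subtype.ext h)
    have hpP : p • (P : geomPoints W) = 0 := by
      have h := (mem_torsionPoints_iff _ _ (P : geomPoints W)).mp P.2
      rwa [natCast_zsmul] at h
    have hpP' : p ^ 1 • (P : geomPoints W) = 0 := by rwa [pow_one]
    have hunip := W.smul_smul_sub_eq_of_mem_inertia_geomPoints hmult hpp hpv le_rfl h𝔓 hτ hpP'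
    have hs : DistribSMul.toAddMonoidHom (geomPoints W) τ (P : geomPoints W) =
        ((((r τ : (ZMod p)ˣ) : ZMod p).val : ℤ)) • (P : geomPoints W) := by
      rw [DistribSMul.toAddMonoidHom_apply, natCast_zsmul]
      have := congrArg (Subtype.val : geomTorsion W p → geomPoints W) (hr τ)
      simpa only [AddSubgroup.torsionBy.coe_smul, AddSubmonoidClass.coe_nsmul] using this
    have h1 := Mazur1978.intCast_eq_one_of_unipotent hpp hP0' hpP
      (DistribSMul.toAddMonoidHom (geomPoints W) τ) hs
      (by simpa only [DistribSMul.toAddMonoidHom_apply] using hunip)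
    rw [Int.cast_natCast, ZMod.natCast_zmod_val] at h1
    exact Units.ext h1

/-- **The isogeny character of a stable line of a semistable `E/ℚ` is a power of the cyclotomic
character**: `r = χ̄_pᵏ` on all of `Γ_ℚ` — Lemme 6 away from `p`, Kronecker–Weber, and "`ℚ`
n'admet pas d'extension non ramifiée" (the tree's
`Mazur1978.exists_forall_eq_mul_modNCyclotomicCharacter_pow` with `n = 1`).
[cite: Serre1972, §5.4, proof of Prop. 21 ii)] -/
theorem exists_isogenyCharacter_eq_pow_of_isSemistable (hsemi : W.IsSemistable (𝓞 ℚ))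
    {P : geomTorsion W p} (hP0 : P ≠ 0) {r : absoluteGaloisGroup ℚ →* (ZMod p)ˣ}
    (hr : ∀ σ : absoluteGaloisGroup ℚ, σ • P = ((r σ : (ZMod p)ˣ) : ZMod p).val • P) :
    ∃ k : ℕ,
      (∀ (v : HeightOneSpectrum (𝓞 ℚ)), (p : 𝓞 ℚ) ∈ v.asIdeal → ∀ 𝔓 ∈ v.primesAbove,
        ∀ τ ∈ 𝔓.inertia (absoluteGaloisGroup ℚ), r τ = modNCyclotomicCharacter ℚ p τ ^ k) ∧
      ∀ σ : absoluteGaloisGroup ℚ, r σ = modNCyclotomicCharacter ℚ p σ ^ k := by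
  have hker := Mazur1978.isOpen_ker_of_smul_eq W p hP0 hr
  obtain ⟨k, hkI, hk⟩ := Mazur1978.exists_forall_eq_mul_modNCyclotomicCharacter_pow p r hker
    (n := 1) (fun v hv 𝔓 h𝔓 τ hτ ↦ by
      rw [pow_one]
      exact isogenyCharacter_eq_one_of_mem_inertia_of_isSemistable hsemi hP0 hr hv h𝔓 hτ)
  refine ⟨k, hkI, fun σ ↦ ?_⟩
  obtain ⟨b, hb, hσ⟩ := hk σ
  rw [pow_one] at hb
  rw [hσ, hb, one_mul]

/-! ### The classes of `k` at a prime of multiplicative reduction (Lemme 5, multiplicative case) -/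

/-- Powers of a unit of `𝔽_p` only depend on the exponent modulo `p - 1`. [folklore] -/
theorem units_zmod_pow_eq_pow_of_modEq {k j : ℕ} (h : k ≡ j [MOD p - 1]) (a : (ZMod p)ˣ) :
    a ^ k = a ^ j := by
  have hred : ∀ n : ℕ, a ^ n = a ^ (n % (p - 1)) := fun n ↦ by
    conv_lhs => rw [← Nat.mod_add_div n (p - 1)]
    rw [pow_add, pow_mul, ZMod.units_pow_card_sub_one_eq_one, one_pow, mul_one]
  unfold Nat.ModEq at h
  rw [hred k, hred j, h]

/-- **Mazur 1978, Prop. 5.1 / Serre 1972, §5.4 Lemme 5 at a prime `p ≠ 2` of multiplicative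
reduction: `k ≡ 0` or `1 (mod p - 1)`.**  Let `P ≠ 0` span a `Γ_ℚ`-stable line of `E[p]` with
isogeny character `r`, `r = χ̄_pᵏ` on the inertia groups above `p`, and let `E` have multiplicative
reduction at `p`.  By the Tate model (§1.12, Cor. of Prop. 13; the tree's
`exists_addSubgroup_card_le_of_hasMultiplicativeReductionAt`) an inertia group `I` at `p` moves
every point of `E[p]` inside a subgroup `X` of order `≤ p`.  If `P ∈ X` then `X = 𝔽_p P` and `I`
acts trivially on `E[p]/𝔽_p P`, i.e. `χ̄ r⁻¹ = 1` on `I`, `k ≡ 1`; if `P ∉ X` then `I` fixes `P`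
(`(r - 1) P ∈ X ∩ 𝔽_p P = 0`), `k ≡ 0` — the values of `χ̄_p` on `I` fill `𝔽_pˣ`
(`exists_mem_inertia_modNCyclotomicCharacter_eq`).  Companion of the tree's
`Mazur1978.modEq_zero_or_one_of_hasGoodReductionAtPrime` (good reduction at `p`).
[cite: Serre1972, §5.4 Lemme 5; §1.12 Cor. of Prop. 13] -/
theorem modEq_zero_or_one_of_hasMultiplicativeReductionAt (hp2 : p ≠ 2)
    {v : HeightOneSpectrum (𝓞 ℚ)} (hv : (primesEquiv v : ℕ) = p)
    (hmult : W.HasMultiplicativeReductionAt v) {P : geomTorsion W p} (hP0 : P ≠ 0)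
    {r : absoluteGaloisGroup ℚ →* (ZMod p)ˣ}
    (hr : ∀ σ : absoluteGaloisGroup ℚ, σ • P = ((r σ : (ZMod p)ˣ) : ZMod p).val • P) {k₀ : ℕ}
    (hk₀ : ∀ (v : HeightOneSpectrum (𝓞 ℚ)), (p : 𝓞 ℚ) ∈ v.asIdeal → ∀ 𝔓 ∈ v.primesAbove,
      ∀ τ ∈ 𝔓.inertia (absoluteGaloisGroup ℚ), r τ = modNCyclotomicCharacter ℚ p τ ^ k₀) :
    k₀ ≡ 0 [MOD p - 1] ∨ k₀ ≡ 1 [MOD p - 1] := by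
  letI : Module (ZMod p) (geomTorsion W p) := AddSubgroup.torsionBy.zmodModule
  have hpp : p.Prime := hp.out
  haveI : NeZero p := ⟨hpp.ne_zero⟩
  haveI : NeZero ((p : ℕ) : ℚ) := ⟨by exact_mod_cast hpp.ne_zero⟩
  have hgen : natGenerator v = p := hv
  have hvp : (p : 𝓞 ℚ) ∈ v.asIdeal := by
    have h := (natGenerator_dvd_iff v).mp dvd_rfl
    rw [← map_natCast (Rat.IsIntegralClosure.intEquiv (𝓞 ℚ)), Ideal.apply_mem_of_equiv_iff] at h
    rwa [hgen] at h
  obtain ⟨𝔓₀, -, h𝔓₀⟩ := exists_ideal_placeOver p hv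
  haveI := h𝔓₀.1
  set χ : absoluteGaloisGroup ℚ →* (ZMod p)ˣ := modNCyclotomicCharacter ℚ p with hχ
  -- a generator `g` of `𝔽_pˣ` and an inertia element `τg` at `𝔓₀` with `χ̄(τg) = g`
  obtain ⟨g, hg⟩ := IsCyclic.exists_generator (α := (ZMod p)ˣ)
  have hordg : orderOf g = p - 1 := by
    rw [orderOf_eq_card_of_forall_mem_zpowers hg, Nat.card_eq_fintype_card, ZMod.card_units]
  obtain ⟨τg, hτgI, hτg⟩ := exists_mem_inertia_modNCyclotomicCharacter_eq (m := p) (p := p)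
    (k := 0) (d := 1) (by rw [zero_add, pow_one, mul_one])
    (fun h1 => hpp.one_lt.ne' (Nat.dvd_one.mp h1)) hgen h𝔓₀ (a := g) (Subsingleton.elim _ _)
  have hrτg : r τg = g ^ k₀ := by rw [hk₀ v hvp 𝔓₀ h𝔓₀ τg hτgI, hτg]
  -- `𝔽_p`-scalars
  have hval : ∀ (c : ZMod p) (S : geomTorsion W p), c.val • S = c • S := fun c S ↦ by
    rw [← Nat.cast_smul_eq_nsmul (ZMod p), ZMod.natCast_zmod_val]
  have hrP : ∀ σ : absoluteGaloisGroup ℚ, σ • P = ((r σ : (ZMod p)ˣ) : ZMod p) • P := fun σ ↦ by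
    rw [hr σ, hval]
  have hcl : ∀ (Y : AddSubgroup (geomTorsion W p)) (c : ZMod p) {Q : geomTorsion W p},
      Q ∈ Y → c • Q ∈ Y := fun Y c Q hQ ↦ by
    rw [← hval]
    exact Y.nsmul_mem hQ _
  -- the subgroup `X`, `#X ≤ p`, receiving `τ x - x` for `τ` in the inertia group at `𝔓₀`
  obtain ⟨X, hXcard, hX⟩ :=
    W.exists_addSubgroup_card_le_of_hasMultiplicativeReductionAt hp2 hvp hmult h𝔓₀
  by_cases hPX : P ∈ X
  · -- `X = 𝔽_p P`: inertia acts trivially on `E[p]/𝔽_p P`, so `χ̄ r⁻¹ (τg) = 1`, `k₀ ≡ 1`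
    right
    have hcardE : Nat.card (geomTorsion W p) = p ^ 2 := natCard_geomTorsion W p
    haveI : Finite (geomTorsion W p) :=
      Nat.finite_of_card_ne_zero (by rw [hcardE]; exact pow_ne_zero 2 hpp.ne_zero)
    have hordP : addOrderOf P = p := addOrderOf_eq_prime_of_ne_zero hP0
    have hle : AddSubgroup.zmultiples P ≤ X := AddSubgroup.zmultiples_le_of_mem hPX
    have hXeq : AddSubgroup.zmultiples P = X :=
      AddSubgroup.eq_of_le_of_card_ge hle (by rw [Nat.card_zmultiples, hordP]; exact hXcard)
    -- a point off the line
    obtain ⟨S, hS⟩ : ∃ S : geomTorsion W p, S ∉ AddSubgroup.zmultiples P := by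
      by_contra h
      push Not at h
      have htop : AddSubgroup.zmultiples P = ⊤ := (AddSubgroup.eq_top_iff' _).mpr h
      have hc := congrArg (fun Y : AddSubgroup (geomTorsion W p) ↦ Nat.card Y) htop
      simp only [Nat.card_zmultiples, hordP, AddSubgroup.card_top, hcardE] at hc
      have : p < p ^ 2 := by nlinarith [hpp.two_le]
      omega
    have hrχ : r τg = χ τg := by
      have h1 : τg • S - S ∈ AddSubgroup.zmultiples P := by rw [hXeq]; exact hX τg hτgI S
      have h2 := Mazur1978.smul_sub_smul_mem_zmultiples_of_isogenyCharacter W p hP0 hr τg S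
      rw [modPCyclotomicCharacterZMod_eq_modNCyclotomicCharacter, ← hχ, hval] at h2
      set d : ZMod p := ((χ τg : (ZMod p)ˣ) : ZMod p) * (((r τg)⁻¹ : (ZMod p)ˣ) : ZMod p)
        with hd
      have h3 : (1 - d) • S ∈ AddSubgroup.zmultiples P := by
        have h := sub_mem h1 h2
        rwa [show τg • S - S - (τg • S - d • S) = -((1 - d) • S) by
          rw [sub_smul, one_smul]; abel, neg_mem_iff] at h
      by_contra hne
      have hd1 : 1 - d ≠ 0 := by
        intro h0
        apply hne
        have : d = 1 := by linear_combination -h0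
        have h4 : (χ τg : (ZMod p)ˣ) * (r τg)⁻¹ = 1 :=
          Units.ext (by rw [Units.val_mul, Units.val_one]; exact this)
        rw [mul_inv_eq_one] at h4
        exact h4.symm
      apply hS
      have := hcl _ (1 - d)⁻¹ h3
      rwa [smul_smul, inv_mul_cancel₀ hd1, one_smul] at this
    rw [hrτg, hτg] at hrχ
    have := pow_eq_pow_iff_modEq.mp (hrχ.trans (pow_one g).symm)
    rwa [hordg] at this
  · -- `P ∉ X`: inertia fixes `P`, so `r (τg) = 1`, `k₀ ≡ 0`
    left
    have hr1 : r τg = 1 := by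
      by_contra hne
      have hne' : ((r τg : (ZMod p)ˣ) : ZMod p) - 1 ≠ 0 := by
        intro h0
        apply hne
        exact Units.ext (by rw [Units.val_one]; linear_combination h0)
      apply hPX
      have hmem : (((r τg : (ZMod p)ˣ) : ZMod p) - 1) • P ∈ X := by
        rw [sub_smul, one_smul, ← hrP]
        exact hX τg hτgI P
      have := hcl X ((((r τg : (ZMod p)ˣ) : ZMod p) - 1)⁻¹) hmem
      rwa [smul_smul, inv_mul_cancel₀ hne', one_smul] at this
    rw [hrτg, ← pow_zero g] at hr1
    have := pow_eq_pow_iff_modEq.mp hr1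
    rwa [hordg] at this

/-! ### Prop. 21 ii): the semi-simplification is `1 ⊕ χ̄_p` -/

variable (W p) in
/-- **Serre 1972, §5.4, Prop. 21 ii) (= Edixhoven 1997, Prop. 2.1, reducible case), for a
globally minimal semistable `E/ℚ`**: if `H ⊂ E[p]` is a `Γ_ℚ`-stable subgroup, `H ≠ 0, E[p]`,
then `Γ_ℚ` fixes `H` pointwise or acts trivially on `E[p]/H` ("les caractères `χ'` et `χ''` …
sont non ramifiés en dehors de `p`, et l'un d'eux est non ramifié en `p` (lemme 5) … égal à `1`").
Proof: `H = 𝔽_p P`; the isogeny character is `r = χ̄_pᵏ`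
(`exists_isogenyCharacter_eq_pow_of_isSemistable`); `k ≡ 0` or `1 (mod p - 1)` — trivially for
`p = 2`, and for `p ≥ 3` by `Mazur1978.modEq_zero_or_one_of_hasGoodReductionAtPrime` (good
reduction at `p`: §1.11) or `modEq_zero_or_one_of_hasMultiplicativeReductionAt` (multiplicative:
§1.12); so `r = 1` (`H` fixed pointwise) or `r = χ̄_p`, and then the quotient character
`χ̄_p r⁻¹` (`Mazur1978.smul_sub_smul_mem_zmultiples_of_isogenyCharacter`, `det ρ̄ = χ̄_p`) is `1`.
[cite: Serre1972, §5.4 Prop. 21 ii) and its proof, Lemmes 5–6]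
[cite: Edixhoven1997, Prop. 2.1 (PDF p. 285)] -/
theorem smul_eq_or_smul_sub_mem_of_isSemistable [W.IsGloballyMinimal]
    (hsemi : W.IsSemistable (𝓞 ℚ)) (H : AddSubgroup (geomTorsion W p))
    (hst : ∀ σ : absoluteGaloisGroup ℚ, ∀ Q ∈ H, σ • Q ∈ H) (hbot : H ≠ ⊥) (htop : H ≠ ⊤) :
    (∀ σ : absoluteGaloisGroup ℚ, ∀ Q ∈ H, σ • Q = Q) ∨
      ∀ (σ : absoluteGaloisGroup ℚ) (Q : geomTorsion W p), σ • Q - Q ∈ H := by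
  letI : Module (ZMod p) (geomTorsion W p) := AddSubgroup.torsionBy.zmodModule
  have hpp : p.Prime := hp.out
  haveI : NeZero p := ⟨hpp.ne_zero⟩
  haveI : NeZero ((p : ℕ) : ℚ) := ⟨by exact_mod_cast hpp.ne_zero⟩
  haveI : Fact (1 < p) := ⟨hpp.one_lt⟩
  -- `H = 𝔽_p P` and its isogeny character `r = χ̄ᵏ`
  obtain ⟨P, hPH, hP0, hHP⟩ := exists_eq_zmultiples_of_ne_bot_of_ne_top W p H hbot htop
  have hstP : ∀ σ : absoluteGaloisGroup ℚ, σ • P ∈ AddSubgroup.zmultiples P := fun σ ↦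
    hHP ▸ hst σ P hPH
  obtain ⟨r, hr⟩ := Mazur1978.exists_isogenyCharacter W p hP0 hstP
  obtain ⟨k, hkI, hk⟩ := exists_isogenyCharacter_eq_pow_of_isSemistable hsemi hP0 hr
  set χ : absoluteGaloisGroup ℚ →* (ZMod p)ˣ := modNCyclotomicCharacter ℚ p with hχ
  have hval : ∀ (c : ZMod p) (S : geomTorsion W p), c.val • S = c • S := fun c S ↦ by
    rw [← Nat.cast_smul_eq_nsmul (ZMod p), ZMod.natCast_zmod_val]
  -- the dichotomy `r = 1` or `r = χ̄`
  have hdich : (∀ σ, r σ = 1) ∨ (∀ σ, r σ = χ σ) := by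
    by_cases hp2 : p = 2
    · left
      intro σ
      have h := ZMod.units_pow_card_sub_one_eq_one p (r σ)
      rwa [show p - 1 = 1 by omega, pow_one] at h
    · have hp3 : 3 ≤ p := by
        have h2 := hpp.two_le
        rcases hpp.eq_two_or_odd with h | h <;> omega
      set v : HeightOneSpectrum (𝓞 ℚ) := primesEquiv.symm ⟨p, hpp⟩ with hvdef
      have hv : (primesEquiv v : ℕ) = p := by rw [hvdef, Equiv.apply_symm_apply]
      have hmod : k ≡ 0 [MOD p - 1] ∨ k ≡ 1 [MOD p - 1] := by
        rcases hsemi v with hgood | hmult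
        · haveI : Fact p.Prime := hp
          have hgood' : W.HasGoodReductionAtPrime p :=
            (hasGoodReductionAtPrime_primesEquiv_iff_holds W v p hv).mpr hgood
          exact Mazur1978.modEq_zero_or_one_of_hasGoodReductionAtPrime W p hp3 hgood' hP0 hr hkI
        · exact modEq_zero_or_one_of_hasMultiplicativeReductionAt hp2 hv hmult hP0 hr hkI
      rcases hmod with h0 | h1
      · left
        intro σ
        rw [hk σ, units_zmod_pow_eq_pow_of_modEq h0, pow_zero]
      · right
        intro σ
        rw [hk σ, units_zmod_pow_eq_pow_of_modEq h1, pow_one]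
  rcases hdich with h1 | hχr
  · -- `r = 1`: `H = 𝔽_p P` is fixed pointwise
    left
    intro σ Q hQ
    rw [hHP] at hQ
    obtain ⟨m, rfl⟩ := AddSubgroup.mem_zmultiples_iff.mp hQ
    have hσP : σ • P = P := by rw [hr σ, h1 σ, Units.val_one, ZMod.val_one, one_smul]
    change DistribSMul.toAddMonoidHom (geomTorsion W p) σ (m • P) = m • P
    rw [map_zsmul, DistribSMul.toAddMonoidHom_apply, hσP]
  · -- `r = χ̄`: the quotient character `χ̄ r⁻¹` is trivial
    right
    intro σ Q
    have h := Mazur1978.smul_sub_smul_mem_zmultiples_of_isogenyCharacter W p hP0 hr σ Q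
    rw [modPCyclotomicCharacterZMod_eq_modNCyclotomicCharacter, ← hχ, ← hχr σ, Units.mul_inv,
      ZMod.val_one, one_smul, ← hHP] at h
    exact h

end WeierstrassCurve

end
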